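import Summits.ResolutionOfSingularities.ResolutionOfSingularities.Theorems.UniversalCellsCampaignW82SmoothTwistGraded
import Mathlib.Algebra.CharP.Lemmas
import HarnessLib

/-!
# [OURS · L1 W8.2] The FROBENIUS-TWIST form of the perfection step of slot W8.2 — one ground field,
# no level quantifier (rung B, prime-field / family transfer) — campaign statements, Theses-free module

Cell `res-hironaka` (run/shared/lean/pub/res-hironaka/), LADDER-RESOLUTION rung L (RESCUE), slot W8.2 of
plan/RESCUE-SEED.md («PRIME-FIELD / UNIVERSALITY TRANSFER instead of descent»), host route `UniversalCells`,
host item `PrimeFieldToPerfect` (stmt-ResolutionOfSingularities-15233); second door `UniformComplexity`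
`PrimeModelTransfer` (stmt-ResolutionOfSingularities-8933). Statement-only file (res-L1-s82-pv-1, gen 2, for
the two-lane desk; proofs in the sibling Theorems/UniversalCellsCampaignW82FrobeniusTwistProofs.lean): one
parametric predicate, one pointwise and one graded OURS `Prop`, two pure-logic anchors; NOTHING is proved about
resolution of singularities here and nothing is asserted.

WHY THIS FILE. The sibling modules (p481193 statements, p481612 / p482106 proofs) show that the residual of
slot W8.2 at a constant field `M` and grade `n`, `CampaignW82.PerfectionStepAt M n` (resolution over `M(t)` in
dimension `≤ n` ⇒ resolution over the perfect `M(t)^{perf}`), is EQUIVALENT to the finite-level smooth-twist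
step `SmoothTwistStepAt M n`, which still quantifies over the finite purely inseparable LEVELS `K ⊇ RatFunc M`
and asks for a smooth model over a FURTHER finite level `K' ⊇ K`. Form (E2) of Cruxes/PrimeFieldToPerfect/KERNEL.md
§2 («Frobenius twists: … some Frobenius twist `X₀^{(p^m)} = X₀ ×_{K,Frob^m} K` has a proper birational model
smooth over `K` (`K' = K^{1/p^m} ≅ K`)») removes BOTH quantifiers: for ANY field `K` of characteristic `p`, the
purely inseparable extension `K ⊆ K^{1/p^e}` is, up to the isomorphism `x ↦ x^{p^e}`, the field `K` regarded as
a `K`-algebra through the iterated Frobenius `Frob^e : K → K`; so «a smooth model over some finite purely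
inseparable level» becomes «a smooth model, over `K` itself, of some Frobenius twist `X₀ ×_{K,Frob^e} Spec K`»,
and a variety over a finite level `K ⊇ RatFunc M` is pushed down to `RatFunc M` along the iterated Frobenius
`K → RatFunc M` (Mathlib `IsPurelyInseparable.iterateFrobenius`). The resulting statement
`FrobeniusTwistStepAt p M n` lives over the SINGLE field `RatFunc M` — hypothesis AND conclusion — and the
sibling proofs file shows `PerfectionStepAt M n ↔ FrobeniusTwistStepAt p M n` for every field `M` of
characteristic `p` (perfectness not used). This is the sharpest normal form of the slot's residual the tree
can state: resolution over `M(t)` in dimension `≤ n` must be improved, for each irreducible geometrically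
reduced `X₀`, to a SMOOTH model of some Frobenius twist of `X₀`, over the same field `M(t)`.

CONTENT (non-embedded summit idiom; Mathlib `iterateFrobenius K p e : K →+* K`, which needs `[ExpChar K p]` —
supplied for fields of characteristic `p` by Mathlib's `expChar_prime` from `[CharP K p] [Fact p.Prime]`):

* `HasSmoothFrobeniusTwistModel p K f₀` — for SOME `e : ℕ` the Frobenius twist
  `X₀^{(p^e)} := X₀ ×_{K, Frob^e} Spec K` (Mathlib `pullback f₀ (Spec.map (iterateFrobenius K p e))`, a
  `K`-scheme through `pullback.snd`) has a proper birational model SMOOTH over `K`.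
* `FrobeniusTwistStepAt p M n` — THE FROBENIUS-TWIST STEP at the constant field `M` of characteristic `p`,
  grade `n`: resolution of integral separated schemes of finite type of dimension `≤ n` over `RatFunc M` ⇒
  every separated `X₀` of finite type and dimension `≤ n` over `RatFunc M` with
  `IntegralOverPerfectClosure (RatFunc M) f₀` has `HasSmoothFrobeniusTwistModel p (RatFunc M) f₀`.
* `FrobeniusTwistStepDimLe p n := ∀ M perfect of characteristic p, FrobeniusTwistStepAt p M n` — the door-1
  graded name (sibling of `PerfectionStepDimLe p n`, `SmoothTwistStepDimLe p n`).
* anchors (pure logic, `Iff.rfl`): `hasSmoothFrobeniusTwistModel_iff`, `frobeniusTwistStepDimLe_iff_forall`.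

THEOREMS-TO-PROVE (names fixed here; sibling proofs file): `hasSmoothFrobeniusTwistModel_of_hasSmoothModelAtFiniteLevel`
(push a smooth model at a finite level `K'` down to `K` along `IsPurelyInseparable.iterateFrobenius K K'`),
`hasResolution_pullback_of_hasSmoothFrobeniusTwistModel` (pull a smooth Frobenius-twist model up to any perfect
`L ⊇ K` along `Frob_L^{-e} ∘ (K → L)`), `frobeniusTwistStepAt_of_smoothTwistStepAt`,
`perfectionStepAt_of_frobeniusTwistStepAt` (descend `X / L` to a finite level `K₁`, push down to `RatFunc M`,
twist, pull up), `perfectionStepAt_iff_frobeniusTwistStepAt`, `perfectionStepDimLe_iff_frobeniusTwistStepDimLe`.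

HONEST FRAMING. The `def`s below are OURS — campaign statements that REPLACE THE ROLE of §17 ¶2, p.89 l.59–62
read with §2 p.4 l.22–24 of H. Hironaka's manuscript *Resolution of singularities in positive characteristics*
(2017-03-23, [Hironaka2017]; typed AS PRINTED as `Literature.AlgebraicGeometry.Hironaka2017.S17Methodology.U89_3` /
`U89_3_ours`; quotes and locators as in the lane-signed p469608, layout lines p.89 L28–L31 / p.4 L21–L23): the
printed «transcendence degree d … dimension d + dim Z» reformulation, to reach a PERFECT base field, needs at
the finite level not a regular but a SMOOTH model OF A FROBENIUS TWIST. NOT statements of the manuscript;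
nothing attributed to its author; no typed candidate used even as a hypothesis. AI transcription, weaker than
expert review.

BUILD RULE (cell, director-resolution 2026-08-26T18:53:29Z (B)): OURS vocabulary file, THESES-FREE BY BIRTH —
imports only the Theses-free p481193 (cones p469608 / p475047), `Mathlib.Algebra.CharP.Lemmas`, `HarnessLib`.

BARRIERS (`Literature/Barriers/ResolutionOfSingularities/`): this is the statement the barrier file
`FrobeniusTwistResolution.lean` (decl `not_hasResolution_Spec_frobTwist`: a Frobenius twist of a non-geometrically-
reduced point has NO resolution) is about — whence the hypothesis `IntegralOverPerfectClosure`, which the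
Negative lemma `Theorems.PrimeFieldToPerfect.Negative.smoothTwist_false_without_geomIntegral` shows cannot be
dropped; `RegularNotGeometricallyRegular.lean` says the twist exponent `e = 0` does not suffice in general
(Kollár's `y² = x^p − t`: `e = 1` does); `InseparableBaseChangeResolution.lean` is not crossed (a SMOOTH model is
transported, legitimately). Open-problem grade for `n ≥ 4`, a theorem for `n ≤ 3` (F-02) / `n ≤ 1`
(unconditional) through the equivalence with `PerfectionStepAt`.

VACUITY SELF-CHECK: `HasSmoothFrobeniusTwistModel p K f₀` is false for `X₀ = Spec K(t^{1/p})` over `K = 𝔽_p(t)`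
(every twist is a non-reduced point; barrier decl `not_hasResolution_Spec_frobTwist`), true for `X₀` smooth
over `K` (`e = 0`, `Frob^0 = id`); `FrobeniusTwistStepAt p M n` / `FrobeniusTwistStepDimLe p n` (prime `p`):
trivially true exactly at `n = ⊥` (an `X₀` integral over the perfect closure is nonempty), never trivially false
(every instance follows from `ResolutionInChar p` through `PerfectionStepAt`), NOT monotone in `n`; composite
`p` cannot occur (`Fact p.Prime`).

## References (vocabulary and locators only; nothing cited as a premise)
* H. Hironaka, ms. 2017-03-23, §17 ¶2 p.89 l.59–62; §2 p.4 l.22–24 — under adjudication, quoted for the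
  role replaced, not asserted. [Hironaka2017]
* J. Kollár, *Lectures on Resolution of Singularities* (2007), Ex. 1.19 area (the cusp `y² = x^p − t`) —
  context for `e = 1`, not used. [Kollar2007]
* Cruxes/PrimeFieldToPerfect/KERNEL.md §2 (E2); STRATEGY-CENSUS.md (`r_F`); plan/RESCUE-SEED.md row W8.2 —
  cell files, OURS.
-/

noncomputable section

set_option linter.dupNamespace false -- mandated namespace of this single-conjunct summit

open _root_.CategoryTheory _root_.CategoryTheory.Limits _root_.AlgebraicGeometry
open Literature.AlgebraicGeometry.Resolution

namespace Summit.ResolutionOfSingularities.ResolutionOfSingularities.Theorems.CampaignW82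

universe u

/-! ## A smooth model of a Frobenius twist -/

/-- [OURS · L1 W8.2] replaces the role of §17 ¶2, p.89 l.59–62 read with §2 p.4 l.22–24 («a perfect base field
K»; typed as `S17Methodology.U89_3_ours`) by naming what the FINITE LEVEL must supply, stated over the ground
field ITSELF; NOT a statement of the manuscript. A SMOOTH MODEL OF A FROBENIUS TWIST: for a field `K` of
exponential characteristic `p` and `f₀ : X₀ ⟶ Spec K` there are `e : ℕ`, a scheme `Y` and a proper birational
`π : Y ⟶ X₀^{(p^e)}` onto the Frobenius twist `X₀^{(p^e)} := X₀ ×_{K, Frob^e} Spec K`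
(`pullback f₀ (Spec.map (iterateFrobenius K p e))`) whose composite with the projection `X₀^{(p^e)} ⟶ Spec K`
is `Smooth`. Since `K → K^{1/p^e}` is `Frob^e : K → K` up to the isomorphism `x ↦ x^{p^e}`, this is
`HasSmoothModelAtFiniteLevel K f₀` with the level pinned to `K^{1/p^e}` and re-read over `K` (sibling proofs:
`hasSmoothFrobeniusTwistModel_of_hasSmoothModelAtFiniteLevel`, and conversely a smooth twisted model yields a
resolution over every perfect `L ⊇ K`, `hasResolution_pullback_of_hasSmoothFrobeniusTwistModel`). Vacuity:
false for `X₀ = Spec 𝔽_p(t^{1/p})` over `𝔽_p(t)` (every twist is one non-reduced point — barrier decl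
`Literature.Barriers.ResolutionOfSingularities.not_hasResolution_Spec_frobTwist`); true with `e = 0` whenever
`X₀ ⟶ Spec K` is smooth; in characteristic `0` (`p = 1`, `Frob = id`) it says `X₀` has a smooth proper
birational model (not intended). [folklore] -/
def HasSmoothFrobeniusTwistModel (p : ℕ) (K : Type u) [Field K] [ExpChar K p] {X₀ : Scheme.{u}}
    (f₀ : X₀ ⟶ Spec (.of K)) : Prop :=
  ∃ (e : ℕ) (Y : Scheme.{u})
    (π : Y ⟶ pullback f₀ (Spec.map (CommRingCat.ofHom (iterateFrobenius K p e)))),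
    IsProper π ∧ IsBirational π ∧
      Smooth (π ≫ pullback.snd f₀ (Spec.map (CommRingCat.ofHom (iterateFrobenius K p e))))

/-! ## The Frobenius-twist step at ONE constant field, and the door-1 graded name -/

/-- [OURS · L1 W8.2] replaces the role of §17 ¶2, p.89 l.59–62 («When the K has transcendence degree d we can
reformulate the resolution problem to the case of dimension d + dim Z») read with §2 p.4 l.22–24 («a perfect
base field K»; typed as `S17Methodology.U89_3_ours`) at transcendence degree one, OVER THE SINGLE FIELD
`RatFunc M`, POINTWISE in the constant field and GRADED BY DIMENSION; NOT a statement of the manuscript. THE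
FROBENIUS-TWIST STEP at `M` (characteristic `p`), grade `n`: if every integral separated scheme of finite type
of dimension `≤ n` over `RatFunc M` has a resolution (the hypothesis block of `PerfectionStepAt M n`, verbatim),
then every separated `f₀ : X₀ ⟶ Spec (RatFunc M)` of finite type with `topologicalKrullDim X₀ ≤ n` and
`IntegralOverPerfectClosure (RatFunc M) f₀` (irreducible and geometrically reduced) has
`HasSmoothFrobeniusTwistModel p (RatFunc M) f₀`: SOME FROBENIUS TWIST of `X₀` has a proper birational model SMOOTH
over `RatFunc M`. EQUIVALENT to `PerfectionStepAt M n` and to `SmoothTwistStepAt M n` for every `M` of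
characteristic `p` (sibling proofs file, `perfectionStepAt_iff_frobeniusTwistStepAt`): form (E2) of
Cruxes/PrimeFieldToPerfect/KERNEL.md §2 — the residual of slot W8.2 with hypothesis and conclusion over ONE
field and no level quantifier. Vacuity (prime `p`): trivially true exactly at `n = ⊥`; never trivially false
(follows from `ResolutionInChar p`); NOT monotone in `n`; open for `n ≥ 4`, a theorem for `n ≤ 3` (F-02) / `n ≤ 1`
through the equivalence. [folklore] -/
def FrobeniusTwistStepAt (p : ℕ) [Fact p.Prime] (M : Type) [Field M] [CharP M p] (n : WithBot ℕ∞) : Prop :=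
  (∀ (X : Scheme.{0}) (f : X ⟶ Spec (.of (RatFunc M))),
      IsSeparated f → LocallyOfFiniteType f → QuasiCompact f → IsIntegral X →
        topologicalKrullDim X ≤ n → Scheme.HasResolution X) →
    ∀ (X₀ : Scheme.{0}) (f₀ : X₀ ⟶ Spec (.of (RatFunc M))),
      IsSeparated f₀ → LocallyOfFiniteType f₀ → QuasiCompact f₀ → topologicalKrullDim X₀ ≤ n →
        IntegralOverPerfectClosure (RatFunc M) f₀ → HasSmoothFrobeniusTwistModel p (RatFunc M) f₀

/-- [OURS · L1 W8.2] replaces the role of §17 ¶2, p.89 l.59–62 read with §2 p.4 l.22–24 («a perfect base field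
K»; typed as `S17Methodology.U89_3_ours`) at transcendence degree one for the target field `M(t)^{perf}`, in
FROBENIUS-TWIST form over `M(t)` itself, GRADED BY DIMENSION — the sibling of `PerfectionStepDimLe p n` and
`SmoothTwistStepDimLe p n`; NOT a statement of the manuscript: `FrobeniusTwistStepAt p M n` for every PERFECT
field `M` of characteristic `p`. EQUIVALENT to `PerfectionStepDimLe p n` (sibling proofs file,
`perfectionStepDimLe_iff_frobeniusTwistStepDimLe`). Vacuity (prime `p`): trivially true exactly at `n = ⊥`;
never trivially false; NOT monotone in `n`. [folklore] -/
def FrobeniusTwistStepDimLe (p : ℕ) [Fact p.Prime] (n : WithBot ℕ∞) : Prop :=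
  ∀ (M : Type) [Field M] [CharP M p] [PerfectField M], FrobeniusTwistStepAt p M n

/-! ## Pure-logic anchors -/

/-- **The predicate, inlined** (definitional, `Iff.rfl`). [folklore] -/
theorem hasSmoothFrobeniusTwistModel_iff (p : ℕ) (K : Type u) [Field K] [ExpChar K p] {X₀ : Scheme.{u}}
    (f₀ : X₀ ⟶ Spec (.of K)) :
    HasSmoothFrobeniusTwistModel p K f₀ ↔
      ∃ (e : ℕ) (Y : Scheme.{u})
        (π : Y ⟶ pullback f₀ (Spec.map (CommRingCat.ofHom (iterateFrobenius K p e)))),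
        IsProper π ∧ IsBirational π ∧
          Smooth (π ≫ pullback.snd f₀ (Spec.map (CommRingCat.ofHom (iterateFrobenius K p e)))) :=
  Iff.rfl

/-- **The door-1 graded Frobenius-twist step is the pointwise one over perfect `M`** (definitional,
`Iff.rfl`). [folklore] -/
theorem frobeniusTwistStepDimLe_iff_forall (p : ℕ) [Fact p.Prime] (n : WithBot ℕ∞) :
    FrobeniusTwistStepDimLe p n ↔
      ∀ (M : Type) [Field M] [CharP M p] [PerfectField M], FrobeniusTwistStepAt p M n :=
  Iff.rfl

/-! ## v2 (append-only): the Frobenius-twist step for REGULAR varieties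

Everything above this line is byte-identical with v1 (p483512). Appended by res-L1-s82-pv-1 (gen 2). The sibling
proofs file Theorems/UniversalCellsCampaignW82RegularFormProofs.lean shows `FrobeniusTwistStepAt p M n ↔
FrobeniusTwistStepRegularAt p M n`: since the hypothesis resolves every `X₀` over `RatFunc M`, and both
«integral over the perfect closure» and «some Frobenius twist has a smooth proper birational model» pass along
proper birational `K`-morphisms (`integralOverPerfectClosure_of_isBirational`,
`hasSmoothFrobeniusTwistModel_of_isBirational`), the residual may be checked on REGULAR `X₀` only. -/

/-- [OURS · L1 W8.2] replaces the role of §17 ¶2, p.89 l.59–62 read with §2 p.4 l.22–24 («a perfect base field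
K»; typed as `S17Methodology.U89_3_ours`) at transcendence degree one, OVER THE SINGLE FIELD `RatFunc M`, for
REGULAR varieties only; NOT a statement of the manuscript. THE FROBENIUS-TWIST STEP FOR REGULAR VARIETIES at `M`
(characteristic `p`), grade `n`: if every integral separated scheme of finite type of dimension `≤ n` over
`RatFunc M` has a resolution (hypothesis block of `PerfectionStepAt M n`, verbatim), then every separated
`f₀ : X₀ ⟶ Spec (RatFunc M)` of finite type with `topologicalKrullDim X₀ ≤ n`,
`IntegralOverPerfectClosure (RatFunc M) f₀` and `X₀` REGULAR (`Scheme.IsRegular X₀`) has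
`HasSmoothFrobeniusTwistModel p (RatFunc M) f₀`. EQUIVALENT to `FrobeniusTwistStepAt p M n` (sibling proofs
file, `frobeniusTwistStepAt_iff_regular`: resolve first, then use that integrality over the perfect closure and
smooth Frobenius-twist models pass along proper birational `K`-morphisms) — so the residual of slot W8.2 asks
exactly: SMOOTH, by a proper birational modification, some Frobenius twist of every REGULAR irreducible
geometrically reduced variety of dimension `≤ n` over `M(t)` — the situation of the barrier examples (Kollár's
regular non-smooth curve `y² = x^p − t`, barrier file `RegularNotGeometricallyRegular.lean`; quasi-elliptic
surfaces). Vacuity (prime `p`): trivially true exactly at `n = ⊥`; true for `X₀` smooth over `RatFunc M`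
(`e = 0`); never trivially false (follows from `ResolutionInChar p` through the equivalences); NOT monotone in
`n`; open for `n ≥ 4`, a theorem for `n ≤ 3` (F-02) / `n ≤ 1`. [folklore] -/
def FrobeniusTwistStepRegularAt (p : ℕ) [Fact p.Prime] (M : Type) [Field M] [CharP M p]
    (n : WithBot ℕ∞) : Prop :=
  (∀ (X : Scheme.{0}) (f : X ⟶ Spec (.of (RatFunc M))),
      IsSeparated f → LocallyOfFiniteType f → QuasiCompact f → IsIntegral X →
        topologicalKrullDim X ≤ n → Scheme.HasResolution X) →
    ∀ (X₀ : Scheme.{0}) (f₀ : X₀ ⟶ Spec (.of (RatFunc M))),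
      IsSeparated f₀ → LocallyOfFiniteType f₀ → QuasiCompact f₀ → topologicalKrullDim X₀ ≤ n →
        IntegralOverPerfectClosure (RatFunc M) f₀ → Scheme.IsRegular X₀ →
          HasSmoothFrobeniusTwistModel p (RatFunc M) f₀

/-- **The regular form is implied by the full Frobenius-twist step** (pure logic: forget the regularity
hypothesis). The converse is `frobeniusTwistStepAt_iff_regular` in the sibling proofs file. [folklore] -/
theorem frobeniusTwistStepRegularAt_of_frobeniusTwistStepAt {p : ℕ} [Fact p.Prime] {M : Type} [Field M]
    [CharP M p] {n : WithBot ℕ∞} (h : FrobeniusTwistStepAt p M n) : FrobeniusTwistStepRegularAt p M n :=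
  fun hM X₀ f₀ hs hl hq hd hint _ => h hM X₀ f₀ hs hl hq hd hint

end Summit.ResolutionOfSingularities.ResolutionOfSingularities.Theorems.CampaignW82

end
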